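import Summits.NavierStokesRegularity.NavierStokesRegularity.Theorems.EfficiencyFloorProductionEfficiencyDecayMeanForm
import HarnessLib

/-!
# Route `EfficiencyFloor`: the MINIMAL PINCER — per blow-up, the floor side («enstrophy super-Leray») and the ceiling side
# («Leray rate recurs») are LITERAL NEGATIONS of each other; the residual `EnstrophyQuarterLaw` (stmt-NavierStokesRegularity-1574)
# is needed only in its recurrent (lim inf) form

Helper file (`--supports stmt-NavierStokesRegularity-1574`). The deciding theorem `Theses.EfficiencyFloor.closes` pincers the
super-Leray floor (fed by `ProductionEfficiencyDecay`, stmt-22866 — in fact by its MEAN form, p825059) against the quarter law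
`EnstrophyQuarterLaw` (`∃ K, ∀ t ∈ [0,T), Z(t) ≤ K/√(T−t)`). This file records the exact logical shape of that pincer:

* `LerayRateRecurrent` (inline): along every maximal classical Leray–Hopf rapidly-decaying-datum solution there is `K` with
  `Z(t) ≤ K/√(T−t)` FREQUENTLY as `t ↑ T` (the blow-up returns to Leray's enstrophy rate at times accumulating at `T`;
  the `lim inf` form of «no enstrophy-Type-II blow-up»). `lerayRateRecurrent_of_enstrophyQuarterLaw`: the filed residual
  implies it (uniform-in-`t` ⟹ frequent).
* `lerayRateRecurrent_iff_not_superLerayFloor` (ONE solution): «Leray rate recurs» is LITERALLY the negation of «super-Leray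
  floor» (`∀ K`, eventually `K/√(T−t) < Z(t)`) — `Filter.not_eventually` and `not_lt`, nothing else.
* `navierStokesRegularity_of_superLerayFloor_of_lerayRateRecurrent`, `navierStokesRegularity_of_meanEfficiencyDecay_of_lerayRateRecurrent`:
  the pincer closes with the floor (or the mean form of stmt-22866) on one side and ONLY the recurrent form of stmt-1574 on the
  other (`Filter.Eventually.and_frequently`), concluding the sub-problem Statement `NavierStokesRegularity` through the landed
  frame `navierStokesRegularity_of_noBlowup` (stmt-0055).

READING (director/planner-facing). Route `EfficiencyFloor` is the case split «for a first blow-up, either `Z(t)²(T−t) → ∞` or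
not»: the attacked conjunct must exclude the first branch for EVERY blow-up (mean efficiency decay ⟺ super-Leray floor,
p825059), the residual must exclude the second (Leray rate recurs ⟹ contradiction, i.e. NO blow-up returns to Leray's rate —
false for every blow-up only if there is none). Both filed items are STRONGER than their roles: stmt-22866 is pointwise (its
mean form suffices), stmt-1574 is uniform in `t` on `[0,T)` (its `lim inf` form suffices). Nothing here bears on which
branch a hypothetical blow-up takes. HONEST FRAMING: pure logic over OPEN statements about a HYPOTHETICAL blow-up;
stmt-22866, stmt-1574, their weak forms and Navier–Stokes regularity stay OPEN; no summit statement is proved. [folklore]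
-/

-- the problem directory repeats the summit name (`NavierStokesRegularity/NavierStokesRegularity`)
set_option linter.dupNamespace false

noncomputable section

namespace Summit.NavierStokesRegularity.NavierStokesRegularity.Theorems

namespace EnstrophyQuarterLaw

namespace MinimalPincer

open Set MeasureTheory Filter Topology Function
open scoped InnerProductSpace ENNReal
open Literature.Analysis.FluidPDE
open Summit.NavierStokesRegularity.NavierStokesRegularity.Theorems.ProductionEfficiencyDecay

/-- **The filed residual implies its recurrent form**: `EnstrophyQuarterLaw` (stmt-1574: `Z(t) ≤ K/√(T−t)` for ALL
`t ∈ [0,T)`) gives `Z(t) ≤ K/√(T−t)` frequently as `t ↑ T`. [folklore] -/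
theorem lerayRateRecurrent_of_enstrophyQuarterLaw
    (hQ : Summit.NavierStokesRegularity.NavierStokesRegularity.Theses.EfficiencyFloor.EnstrophyQuarterLaw) :
    ∀ (ν T : ℝ), 0 < ν → 0 < T → ∀ (u : ℝ → EuclideanSpace ℝ (Fin 3) → EuclideanSpace ℝ (Fin 3)) (p : ℝ →
      EuclideanSpace ℝ (Fin 3) → ℝ), Literature.Analysis.FluidPDE.IsMaximalSmoothSolution ν 0 u p T →
      Literature.Analysis.FluidPDE.IsLerayHopfOn T ν 0 (u 0) u → Literature.Analysis.FluidPDE.HasRapidSpatialDecay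
      (u 0) → ∃ K : ℝ, ∃ᶠ t in nhdsWithin T (Set.Iio T), ∫⁻ x, ‖Literature.Analysis.FluidPDE.curl (u t) x‖ₑ ^ 2 ≤
      ENNReal.ofReal (K / Real.sqrt (T - t)) := by
  intro ν T hν hT u p hmax hLH hdec
  obtain ⟨K, hK⟩ := hQ ν T hν hT u p hmax hLH hdec
  refine ⟨K, Eventually.frequently ?_⟩
  filter_upwards [Ico_mem_nhdsLT hT] with t ht using hK t ht

/-- **Per blow-up, the two sides of the pincer are negations of each other**: for ONE solution `u` on `[0,T)`,
«Leray rate recurs» (`∃ K`, frequently `Z(t) ≤ K/√(T−t)`) holds IFF the super-Leray floor (`∀ K`, eventually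
`K/√(T−t) < Z(t)`) FAILS. [folklore] -/
theorem lerayRateRecurrent_iff_not_superLerayFloor {T : ℝ}
    {u : ℝ → EuclideanSpace ℝ (Fin 3) → EuclideanSpace ℝ (Fin 3)} :
    (∃ K : ℝ, ∃ᶠ t in nhdsWithin T (Set.Iio T), ∫⁻ x, ‖Literature.Analysis.FluidPDE.curl (u t) x‖ₑ ^ 2 ≤
        ENNReal.ofReal (K / Real.sqrt (T - t))) ↔ ¬ (∀ K : ℝ, ∀ᶠ t in nhdsWithin T (Set.Iio T), ENNReal.ofReal (K / Real.sqrt (T - t)) < ∫⁻ x,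
        ‖Literature.Analysis.FluidPDE.curl (u t) x‖ₑ ^ 2) := by
  constructor
  · rintro ⟨K, hK⟩ hF
    exact hK (by filter_upwards [hF K] with t ht using not_le.2 ht)
  · intro hF
    simp only [not_forall, not_eventually, not_lt] at hF
    exact hF

/-- **The pincer with the recurrent residual**: the super-Leray floor for every maximal classical Leray–Hopf
rapidly-decaying-datum solution and «Leray rate recurs» for every such solution together imply the sub-problem Statement
(there is then no such solution: stmt-0055 frame). An IMPLICATION between open statements. [folklore] -/
theorem navierStokesRegularity_of_superLerayFloor_of_lerayRateRecurrent
    (hF : ∀ (ν T : ℝ), 0 < ν → 0 < T → ∀ (u : ℝ → EuclideanSpace ℝ (Fin 3) → EuclideanSpace ℝ (Fin 3)) (p : ℝ →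
      EuclideanSpace ℝ (Fin 3) → ℝ), Literature.Analysis.FluidPDE.IsMaximalSmoothSolution ν 0 u p T →
      Literature.Analysis.FluidPDE.IsLerayHopfOn T ν 0 (u 0) u → Literature.Analysis.FluidPDE.HasRapidSpatialDecay
      (u 0) → ∀ K : ℝ, ∀ᶠ t in nhdsWithin T (Set.Iio T), ENNReal.ofReal (K / Real.sqrt (T - t)) < ∫⁻ x,
      ‖Literature.Analysis.FluidPDE.curl (u t) x‖ₑ ^ 2)
    (hR : ∀ (ν T : ℝ), 0 < ν → 0 < T → ∀ (u : ℝ → EuclideanSpace ℝ (Fin 3) → EuclideanSpace ℝ (Fin 3)) (p : ℝ →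
      EuclideanSpace ℝ (Fin 3) → ℝ), Literature.Analysis.FluidPDE.IsMaximalSmoothSolution ν 0 u p T →
      Literature.Analysis.FluidPDE.IsLerayHopfOn T ν 0 (u 0) u → Literature.Analysis.FluidPDE.HasRapidSpatialDecay
      (u 0) → ∃ K : ℝ, ∃ᶠ t in nhdsWithin T (Set.Iio T), ∫⁻ x, ‖Literature.Analysis.FluidPDE.curl (u t) x‖ₑ ^ 2 ≤
      ENNReal.ofReal (K / Real.sqrt (T - t))) :
    NavierStokesRegularity := by
  apply Summit.NavierStokesRegularity.NavierStokesRegularity.Theorems.navierStokesRegularity_of_noBlowup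
  intro ν T hν hT0 u p hcl hLH hdec
  by_contra hext
  have hmax : IsMaximalSmoothSolution ν 0 u p T := ⟨hcl, hext⟩
  obtain ⟨K, hK⟩ := hR ν T hν hT0 u p hmax hLH hdec
  have hSL := hF ν T hν hT0 u p hmax hLH hdec K
  obtain ⟨t, ht, hle⟩ := (hSL.and_frequently hK).exists
  exact absurd hle (not_le.2 ht)

/-- **Mean efficiency decay ∧ Leray-rate recurrence ⟹ `NavierStokesRegularity`**: the minimal pincer — the mean form of
stmt-22866 (p825059) on the floor side, the recurrent form of stmt-1574 on the ceiling side. An IMPLICATION between open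
statements. [folklore] -/
theorem navierStokesRegularity_of_meanEfficiencyDecay_of_lerayRateRecurrent
    (hM : ∀ (ν T : ℝ), 0 < ν → 0 < T → ∀ (u : ℝ → EuclideanSpace ℝ (Fin 3) → EuclideanSpace ℝ (Fin 3)) (p : ℝ →
      EuclideanSpace ℝ (Fin 3) → ℝ), Literature.Analysis.FluidPDE.IsMaximalSmoothSolution ν 0 u p T →
      Literature.Analysis.FluidPDE.IsLerayHopfOn T ν 0 (u 0) u → Literature.Analysis.FluidPDE.HasRapidSpatialDecay
      (u 0) → ∀ ε : ℝ, 0 < ε → ∃ t₁ ∈ Set.Ico 0 T, ∀ s ∈ Set.Ico t₁ T, (0 < ∫⁻ x,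
      ‖Literature.Analysis.FluidPDE.curl (u s) x‖ₑ ^ 2 ∧ ∫⁻ x, ‖Literature.Analysis.FluidPDE.curl (u s) x‖ₑ ^ 2 <
      ⊤) ∧ ((∫⁻ x, ‖Literature.Analysis.FluidPDE.curl (u s) x‖ₑ ^ 2).toReal)⁻¹ ^ 2 ≤ ε * (T - s))
    (hR : ∀ (ν T : ℝ), 0 < ν → 0 < T → ∀ (u : ℝ → EuclideanSpace ℝ (Fin 3) → EuclideanSpace ℝ (Fin 3)) (p : ℝ →
      EuclideanSpace ℝ (Fin 3) → ℝ), Literature.Analysis.FluidPDE.IsMaximalSmoothSolution ν 0 u p T →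
      Literature.Analysis.FluidPDE.IsLerayHopfOn T ν 0 (u 0) u → Literature.Analysis.FluidPDE.HasRapidSpatialDecay
      (u 0) → ∃ K : ℝ, ∃ᶠ t in nhdsWithin T (Set.Iio T), ∫⁻ x, ‖Literature.Analysis.FluidPDE.curl (u t) x‖ₑ ^ 2 ≤
      ENNReal.ofReal (K / Real.sqrt (T - t))) :
    NavierStokesRegularity :=
  navierStokesRegularity_of_superLerayFloor_of_lerayRateRecurrent (MeanForm.superLerayFloor_of_meanEfficiencyDecay hM) hR

/-- **The filed pair also closes through the minimal pincer** (consistency check against `Theses.EfficiencyFloor.closes`):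
`ProductionEfficiencyDecay ∧ EnstrophyQuarterLaw ⟹ NavierStokesRegularity`. [folklore] -/
theorem navierStokesRegularity_of_filed_pair
    (hE : Summit.NavierStokesRegularity.NavierStokesRegularity.Theses.EfficiencyFloor.ProductionEfficiencyDecay)
    (hQ : Summit.NavierStokesRegularity.NavierStokesRegularity.Theses.EfficiencyFloor.EnstrophyQuarterLaw) :
    NavierStokesRegularity :=
  navierStokesRegularity_of_superLerayFloor_of_lerayRateRecurrent
    (MeanForm.superLerayFloor_of_productionEfficiencyDecay hE) (lerayRateRecurrent_of_enstrophyQuarterLaw hQ)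

end MinimalPincer

end EnstrophyQuarterLaw

end Summit.NavierStokesRegularity.NavierStokesRegularity.Theorems

end
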